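import Summits.CriticalPhenomena.PercolationContinuityZ3.Theorems.PercNearOneGluingNoHeavyLowerTailKnQuestion8CoefficientwiseNoCoreParallelTame
import HarnessLib

/-!
# CONJECTURE NO-CORE is stable under adding an `x–z` path of length two — prim-lf-2 gen 55

Support file (`--supports stmt-CriticalPhenomena-4575`, closed), prover `prim-lf-2` (gen 55).  No definitions, no named facts, no sorries; standard axioms.
Memo `prim-lf-2/CW-TWOSOURCESYM-gen55.md` §3.6; this is the first instance of `noCore_parallel_tame` (`…CoefficientwiseNoCoreParallelTame.lean`): the two-edge path `x–a–z` is a TAME piece.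

* `Coefficientwise.noCore_add_path_two` — if `(E₁; x, z) ∈ 𝒩` (NO-CORE for all monotone `φ, ψ`), and `e₁, e₂ ∉ E₁` are two edges with ends `{x, a}`, `{a, z}` where the new vertex `a` lies on no
  edge of `E₁` (`a, x, z` distinct), then `(E₁ ∪ {e₁, e₂}; x, z) ∈ 𝒩`.
Iterating from the base member 'one edge `x–z`' or from any member: `K_{2,n}` with `x, z` the two poles, every member of `𝒩` with any number of extra `x–z` paths of length two, and (with
`noCore_series`, `noCore_decoration`) their series compositions and decorations all satisfy CONJECTURE NO-CORE for all monotone `f, g`.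
[cite: KozmaNitzan2024, Questions 8–9 (§5.5 p. 36) (context: the Question-8 pocket covariance programme)]
-/

namespace Summit.CriticalPhenomena.PercolationContinuityZ3.Theorems

open Finset Literature.Probability.Percolation

namespace Coefficientwise

variable {ι V : Type*} [Fintype ι] [DecidableEq ι]

omit [Fintype ι] in
open Classical in
/-- **Adding an `x–z` path of length two preserves NO-CORE.**  [cite: KozmaNitzan2024, Questions 8–9 (§5.5 p. 36) (context)] -/
theorem noCore_add_path_two (ends : ι → Sym2 V) {E₁ : Finset ι} {x z a : V} {e₁ e₂ : ι}
    (he₁E : e₁ ∉ E₁) (he₂E : e₂ ∉ E₁) (he₁₂ : e₁ ≠ e₂) (he₁ : ends e₁ = s(x, a)) (he₂ : ends e₂ = s(a, z))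
    (hax : a ≠ x) (haz : a ≠ z) (hzx : z ≠ x) (ha : ∀ e ∈ E₁, a ∉ ends e)
    (h₁ : ∀ φ ψ : Set V → ℝ, Monotone φ → Monotone ψ →
      0 ≤ ∑ s ∈ E₁.powerset.filter (fun s : Finset ι => ¬ (z ∈ openCluster (ends '' (↑s : Set ι)) x ∧
            z ∈ openCluster (ends '' (↑(E₁ \ s) : Set ι)) x)),
        (φ (openCluster (ends '' (↑s : Set ι)) x) - φ (openCluster (ends '' (↑(E₁ \ s) : Set ι)) x)) *
          (ψ (openCluster (ends '' (↑s : Set ι)) x) - ψ (openCluster (ends '' (↑(E₁ \ s) : Set ι)) x)))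
    (f g : Set V → ℝ) (hf : Monotone f) (hg : Monotone g) :
    0 ≤ ∑ s ∈ (E₁ ∪ {e₁, e₂}).powerset.filter (fun s : Finset ι => ¬ (z ∈ openCluster (ends '' (↑s : Set ι)) x ∧
          z ∈ openCluster (ends '' (↑((E₁ ∪ {e₁, e₂}) \ s) : Set ι)) x)),
      (f (openCluster (ends '' (↑s : Set ι)) x) - f (openCluster (ends '' (↑((E₁ ∪ {e₁, e₂}) \ s) : Set ι)) x)) *
        (g (openCluster (ends '' (↑s : Set ι)) x) - g (openCluster (ends '' (↑((E₁ ∪ {e₁, e₂}) \ s) : Set ι)) x)) := by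
  set E₂ : Finset ι := {e₁, e₂} with hE₂
  set K : Finset ι → Set V := fun s => openCluster (ends '' (↑s : Set ι)) x with hK
  set Kz : Finset ι → Set V := fun s => openCluster (ends '' (↑s : Set ι)) z with hKz
  have memE₂ : ∀ i, i ∈ E₂ ↔ i = e₁ ∨ i = e₂ := fun i => by simp [hE₂]
  have hE : Disjoint E₁ E₂ := by
    rw [Finset.disjoint_right]
    intro i hi
    rcases (memE₂ i).mp hi with rfl | rfl
    · exact he₁E
    · exact he₂E
  have hsep : ∀ e ∈ E₁, ∀ e' ∈ E₂, ∀ w : V, w ∈ ends e → w ∈ ends e' → w = x ∨ w = z := by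
    intro e he e' he' w hw hw'
    rcases (memE₂ e').mp he' with rfl | rfl
    · rw [he₁, Sym2.mem_iff] at hw'
      rcases hw' with rfl | rfl
      · exact Or.inl rfl
      · exact absurd hw (ha e he)
    · rw [he₂, Sym2.mem_iff] at hw'
      rcases hw' with rfl | rfl
      · exact absurd hw (ha e he)
      · exact Or.inr rfl
  -- clusters of the colourings of the two-edge path
  have adj_iff : ∀ (s : Finset ι) (c d : V), (openGraph (ends '' (↑s : Set ι))).Adj c d → ∃ i ∈ s, ends i = s(c, d) := by
    intro s c d h
    rw [openGraph_image_adj] at h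
    exact h.1
  -- (C1) without `e₁` the cluster of `x` is `{x}`
  have C1 : ∀ s : Finset ι, s ⊆ E₂ → e₁ ∉ s → K s ⊆ {x} := by
    intro s hs h1
    refine openCluster_subset_of_adjClosed ends x (↑s : Set ι) {x} rfl ?_
    intro c hc d hcd
    rw [Set.mem_singleton_iff] at hc
    rw [hc] at hcd
    obtain ⟨i, hi, hic⟩ := adj_iff s x d hcd
    rcases (memE₂ i).mp (hs hi) with hi1 | hi2
    · exact absurd (hi1 ▸ hi) h1
    · exfalso
      have : x ∈ ends e₂ := by rw [← hi2, hic]; exact Sym2.mem_mk_left x d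
      rw [he₂, Sym2.mem_iff] at this
      rcases this with h | h
      · exact hax h.symm
      · exact hzx h.symm
  -- (C2) without `e₂` the cluster of `z` is `{z}`
  have C2 : ∀ s : Finset ι, s ⊆ E₂ → e₂ ∉ s → Kz s ⊆ {z} := by
    intro s hs h2
    refine openCluster_subset_of_adjClosed ends z (↑s : Set ι) {z} rfl ?_
    intro c hc d hcd
    rw [Set.mem_singleton_iff] at hc
    rw [hc] at hcd
    obtain ⟨i, hi, hic⟩ := adj_iff s z d hcd
    rcases (memE₂ i).mp (hs hi) with hi1 | hi2
    · exfalso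
      have : z ∈ ends e₁ := by rw [← hi1, hic]; exact Sym2.mem_mk_left z d
      rw [he₁, Sym2.mem_iff] at this
      rcases this with h | h
      · exact hzx h
      · exact haz h.symm
    · exact absurd (hi2 ▸ hi) h2
  -- (C3) without `e₂` the cluster of `x` is inside `{x, a}`
  have C3 : ∀ s : Finset ι, s ⊆ E₂ → e₂ ∉ s → K s ⊆ {w | w = x ∨ w = a} := by
    intro s hs h2
    refine openCluster_subset_of_adjClosed ends x (↑s : Set ι) {w | w = x ∨ w = a} (Or.inl rfl) ?_
    intro c _ d hcd
    obtain ⟨i, hi, hic⟩ := adj_iff s c d hcd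
    rcases (memE₂ i).mp (hs hi) with hi1 | hi2
    · have : d ∈ ends e₁ := by rw [← hi1, hic]; exact Sym2.mem_mk_right c d
      rw [he₁, Sym2.mem_iff] at this
      exact this
    · exact absurd (hi2 ▸ hi) h2
  -- (C4) with `e₂`, `a` is in the cluster of `z`
  have C4 : ∀ s : Finset ι, e₂ ∈ s → a ∈ Kz s := by
    intro s h2
    have hadj : (openGraph (ends '' (↑s : Set ι))).Adj z a := by
      rw [openGraph_image_adj]
      exact ⟨⟨e₂, h2, by rw [he₂, Sym2.eq_swap]⟩, haz.symm⟩
    exact hadj.reachable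
  -- (C5) with both edges, `z` is in the cluster of `x`
  have C5 : ∀ s : Finset ι, e₁ ∈ s → e₂ ∈ s → z ∈ K s := by
    intro s h1 h2
    have hadj1 : (openGraph (ends '' (↑s : Set ι))).Adj x a := by
      rw [openGraph_image_adj]; exact ⟨⟨e₁, h1, he₁⟩, hax.symm⟩
    have hadj2 : (openGraph (ends '' (↑s : Set ι))).Adj a z := by
      rw [openGraph_image_adj]; exact ⟨⟨e₂, h2, he₂⟩, haz⟩
    exact hadj1.reachable.trans hadj2.reachable
  have hxK : ∀ s : Finset ι, x ∈ K s := fun s => mem_openCluster_self _ x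
  -- the comparability of the glued sets for a 'red-first' versus a 'blue-first' colouring
  have cmp : ∀ s s' : Finset ι, s ⊆ E₂ → s' ⊆ E₂ → e₁ ∈ s → e₂ ∉ s → e₁ ∉ s' → e₂ ∈ s' → ∀ X : Set V,
      (X ∪ {w | z ∈ X ∧ w ∈ Kz s} ∪ K s ⊆ X ∪ {w | z ∈ X ∧ w ∈ Kz s'} ∪ K s') ∨
      (X ∪ {w | z ∈ X ∧ w ∈ Kz s'} ∪ K s' ⊆ X ∪ {w | z ∈ X ∧ w ∈ Kz s} ∪ K s) := by
    intro s s' hs hs' h1 h2 h1' h2' X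
    by_cases hzX : z ∈ X
    · left
      intro w hw
      rcases hw with (hw | ⟨_, hw⟩) | hw
      · exact Or.inl (Or.inl hw)
      · have : w = z := C2 s hs h2 hw
        subst this
        exact Or.inl (Or.inl hzX)
      · rcases C3 s hs h2 hw with rfl | rfl
        · exact Or.inr (hxK s')
        · exact Or.inl (Or.inr ⟨hzX, C4 s' h2'⟩)
    · right
      intro w hw
      rcases hw with (hw | ⟨hz, _⟩) | hw
      · exact Or.inl (Or.inl hw)
      · exact absurd hz hzX
      · have : w = x := C1 s' hs' h1' hw
        subst this
        exact Or.inr (hxK s)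
  -- tameness (Ta)
  have hTa : ∀ s₂, s₂ ⊆ E₂ → z ∈ K s₂ → z ∉ K (E₂ \ s₂) → K (E₂ \ s₂) ⊆ K s₂ := by
    intro s₂ hs₂ hz1 _
    have h1 : e₁ ∈ s₂ := by
      by_contra h1
      exact hzx (C1 s₂ hs₂ h1 hz1)
    have h1' : e₁ ∉ E₂ \ s₂ := fun h => (Finset.mem_sdiff.mp h).2 h1
    intro w hw
    have : w = x := C1 (E₂ \ s₂) Finset.sdiff_subset h1' hw
    subst this
    exact hxK s₂
  -- tameness (Tb)
  have hTb : ∀ s₂, s₂ ⊆ E₂ → z ∉ K s₂ → z ∉ K (E₂ \ s₂) → ∀ X : Set V,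
      (X ∪ {w | z ∈ X ∧ w ∈ Kz s₂} ∪ K s₂ ⊆ X ∪ {w | z ∈ X ∧ w ∈ Kz (E₂ \ s₂)} ∪ K (E₂ \ s₂)) ∨
      (X ∪ {w | z ∈ X ∧ w ∈ Kz (E₂ \ s₂)} ∪ K (E₂ \ s₂) ⊆ X ∪ {w | z ∈ X ∧ w ∈ Kz s₂} ∪ K s₂) := by
    intro s₂ hs₂ hz1 hz2 X
    have he₁E₂ : e₁ ∈ E₂ := (memE₂ e₁).mpr (Or.inl rfl)
    have he₂E₂ : e₂ ∈ E₂ := (memE₂ e₂).mpr (Or.inr rfl)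
    by_cases h1 : e₁ ∈ s₂
    · have h2 : e₂ ∉ s₂ := fun h2 => hz1 (C5 s₂ h1 h2)
      have h1' : e₁ ∉ E₂ \ s₂ := fun h => (Finset.mem_sdiff.mp h).2 h1
      have h2' : e₂ ∈ E₂ \ s₂ := Finset.mem_sdiff.mpr ⟨he₂E₂, h2⟩
      exact cmp s₂ (E₂ \ s₂) hs₂ Finset.sdiff_subset h1 h2 h1' h2' X
    · have h1' : e₁ ∈ E₂ \ s₂ := Finset.mem_sdiff.mpr ⟨he₁E₂, h1⟩
      have h2' : e₂ ∉ E₂ \ s₂ := fun h2' => hz2 (C5 (E₂ \ s₂) h1' h2')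
      have h2 : e₂ ∈ s₂ := by
        by_contra h2
        exact h2' (Finset.mem_sdiff.mpr ⟨he₂E₂, h2⟩)
      rcases cmp (E₂ \ s₂) s₂ Finset.sdiff_subset hs₂ h1' h2' h1 h2 X with h | h
      · exact Or.inr h
      · exact Or.inl h
  exact noCore_parallel_tame ends hE hsep h₁ hTa hTb f g hf hg

end Coefficientwise

end Summit.CriticalPhenomena.PercolationContinuityZ3.Theorems
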